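import Summits.HodgeConjecture.CorCM.Hyp413.A3Liu413FaceTypes
import Literature.NumberTheory.Automorphic.Liu2021.Def412AdmissibleIffParity
import Summits.HodgeConjecture.CorCM.Hyp413.A3Liu413RogawskiFaceTypes
import HarnessLib

/-!
# [Liu2021, Def. 4.12] ⟺ parity AT THE PIN `datum413` — the closer of (T4) ROG-SPEC's `stub_G2` (R1)

Cell hodgecm-mathlib, fan B-III (T4) «Rogawski 1990 for our inner form → the h413 rows», B-plan2's workfile
`Cruxes/H413/Lines/rogawski_multone.lean` (v1 87cf52de): its stub `stub_G2 : StubG2` reads, for every face prefix and every oscillator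
triple `t` of the printed datum `datum413`, «`t.IsAdmissible ↔ Parity … t`».  Since `(datum413 …).Eps = Def411WeilCarriers.Eps K⁺ (imagUnitSq K)`
and `(datum413 …).epsOf = Def411WeilCarriers.epsOf K⁺ (imagUnitSq K) K (2·imagUnit K)⁻¹` DEFINITIONALLY (`UniformOmega.prop413Data`,
`uniformOmegaRep`), `Triple.IsAdmissible t` is the left-hand side of ★ `Liu2021.isAdmissible_epsOf_iff_even` (p631997, over the first rung
★ `QuadraticForms.exists_prescribed_normClass_sign_iff_even` p631334 = O'Meara 71:18/71:19) at `(K F, t.cmType, δ := (2·imagUnit)⁻¹,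
d := imagUnitSq)`, and `Parity … t` is its right-hand side: this file states the equivalence at the pin (`isAdmissible_datum413_iff_even`);
the by-name closer `stubG2_holds : StubG2` is appended once the stub TYPES module `CorCM/Hyp413/A3Liu413RogawskiFaceTypes.lean` (T4-τ0) lands.
Item stmt-HodgeConjecture-24833 (h413) `--supports`; no floor change.  HC_CM is proved only modulo the 7 printed citations until rung 0 closes.
-/

noncomputable section

open NumberField IsDedekindDomain
open Literature.AlgebraicGeometry.Motives (CMType)
open Literature.NumberTheory.Automorphic.Liu2021
open Literature.NumberTheory.GelbartRogawski1991.UnitaryDualPair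
open Summit.HodgeConjecture.CorCM.Lines.A3Liu413
open Summit.HodgeConjecture.CorCM.Transposition.OmegaTransport (complexConj_inv_two_mul_imagUnit inv_two_mul_imagUnit_ne_zero)
open HodgeCM.Model HodgeCM.Model.LiuIndex

namespace Summit.HodgeConjecture.CorCM.Lines.A3Liu413

set_option synthInstance.maxHeartbeats 400000 in
set_option maxHeartbeats 8000000 in
/-- **[Liu2021, Def. 4.12] ⟺ parity at the printed datum `datum413`**: for every face prefix, admissible index and oscillator triple
`t` of the pin, «`t.ε` is `μ_t`-admissible» iff `{v | t.ε v ≠ 1}` is finite and `#{v | t.ε v ≠ 1} + #{φ ∈ Φ_{μ_t} | 0 < Im φ((2δ_K)⁻¹)}`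
is even — ★ `isAdmissible_epsOf_iff_even` read at the pin's Def411 carriers (`rfl`), `d := imagUnitSq` negative at every real place by
`embedding_of_isReal_lt_zero_of_coe_eq_mul_self` on `imagUnit`.
[cite: Liu2021, Def. 4.12 (l. 2102–2108), Rem. 4.14] [cite: Omeara1963, §71 Thm. 71:18, Thm. 71:19] -/
theorem isAdmissible_datum413_iff_even
    (hDel : Literature.AlgebraicGeometry.ShimuraVarieties.UnitaryCanonicalModel.canonicalModel_exists_printed)
    (F : HodgeCM.CMField) [IsGalois ℚ F] {ι₁ : F →+* ℂ} (V : HodgeCM.HermSpace3 F ι₁) (a₀ : RealScalar F)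
    (Φ : CMType F) (i : (I V (repAt a₀) (muLiu ι₁ GramClass.rep))) (t : (datum413 hDel F V a₀ Φ i).Triple) :
    t.IsAdmissible ↔
      ({v : HeightOneSpectrum (𝓞 ↥(maximalRealSubfield (HodgeCM.CMField.K F))) | t.ε v ≠ 1}.Finite ∧
        Even ({v : HeightOneSpectrum (𝓞 ↥(maximalRealSubfield (HodgeCM.CMField.K F))) | t.ε v ≠ 1}.ncard +
          {φ : HodgeCM.CMField.K F →+* ℂ | φ ∈ t.cmType.1 ∧ 0 < (φ (2 * imagUnit (HodgeCM.CMField.K F))⁻¹).im}.ncard)) :=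
  isAdmissible_epsOf_iff_even (HodgeCM.CMField.K F) t.cmType
    (complexConj_inv_two_mul_imagUnit ⟨HodgeCM.CMField.K F⟩) (inv_two_mul_imagUnit_ne_zero ⟨HodgeCM.CMField.K F⟩)
    (imagUnitSq (HodgeCM.CMField.K F))
    (ne_zero_of_coe_eq_mul_self (imagUnit_ne_zero (HodgeCM.CMField.K F)) (imagUnit_mul_self (HodgeCM.CMField.K F)).symm)
    (embedding_of_isReal_lt_zero_of_coe_eq_mul_self (complexConj_imagUnit (HodgeCM.CMField.K F))
      (imagUnit_ne_zero (HodgeCM.CMField.K F)) (imagUnit_mul_self (HodgeCM.CMField.K F)).symm)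
    t.ε

set_option synthInstance.maxHeartbeats 400000 in
set_option maxHeartbeats 8000000 in
/-- **`stub_G2` CLOSED BY NAME — [Liu2021, Def. 4.12] ⟺ `Parity` at the pin, for every face prefix** ((T4) ROG-SPEC S6 / R1): the
stub TYPE `StubG2` of `CorCM/Hyp413/A3Liu413RogawskiFaceTypes.lean` (= `Cruxes/H413/Lines/rogawski_multone.lean` :175 byte for byte),
by `isAdmissible_datum413_iff_even` (★ `Liu2021.isAdmissible_epsOf_iff_even` over ★ `QuadraticForms.exists_prescribed_normClass_sign_iff_even`,
O'Meara 71:18/71:19); `Parity`'s `let ε := t.ε` and the pin's carrier `rfl`s reduce silently.  HC_CM is proved only modulo the 7 printed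
citations until rung 0 closes. [cite: Liu2021, Def. 4.12 (ll. 2102–2108), Rem. 4.14] [cite: Rogawski1990, Thm. 14.6.4] [cite: Omeara1963, §71 Thm. 71:18, Thm. 71:19] -/
theorem stubG2_holds : StubG2 :=
  fun hDel F _ _h6 _ι₁ V a₀ Φ _hΦ i t => isAdmissible_datum413_iff_even hDel F V a₀ Φ i t

end Summit.HodgeConjecture.CorCM.Lines.A3Liu413

end
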